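import Literature.Barriers.NavierStokesRegularity.AxisymmetricTypeIExclusion
import Literature.Analysis.FluidPDE.KNSSNoAxisymmetricTypeIHolds
import HarnessLib

/-!
# Barrier `AxisymmetricTypeIExclusion` — discharged

Barrier-catalogue glue file for `NavierStokesRegularity` (D-0021) **discharging the barrier fact
`Literature.Barriers.NavierStokesRegularity.AxisymmetricTypeIExclusion`**
(`AxisymmetricTypeIExclusion.lean`: Seregin–Šverák 2009, Thm. 3.1 = Thm. 1.1 — an axisymmetric
distributional solution in the unit cylinder `𝒞 × ]-1,0[` with `u ∈ L³`, `p ∈ L^{3/2}` and the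
Type I bound `|u| ≤ C/√(-t)` is regular at the space–time origin) **under its canonical name**.
The statement is already a theorem of the tree,
`Literature.Analysis.FluidPDE.axisymmetricTypeIExclusion_of_tree`
(`Literature/Analysis/FluidPDE/KNSSNoAxisymmetricTypeIHolds.lean`: the accepted three-leaf
reduction `axisymmetricTypeIExclusion_of_offAxisBound_of_localHolderBound` of
`AxisymmetricTypeIExclusionProofs.lean` fed with `SereginSverak2009.OffAxisBound_holds`,
`SereginSverak2009.LocalHolderBound_holds` and `KNSS2009_liouville_bound_C_over_r_holds`, all
fully proved); this file only files the `_holds` form in the barrier directory, as announced in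
the docstring of `axisymmetricTypeIExclusion_of_tree`, so that the fact index and the cone
inventory of `NavierStokesRegularity` register the barrier as discharged. The structured
docstring of the barrier (technique class, blocks, because, evasions, scope) is unchanged in
`AxisymmetricTypeIExclusion.lean`.

Theorem-only glue module: no definitions, no named facts, no `sorry`.

## References

* G. Seregin, V. Šverák, *On Type I singularities of the local axi-symmetric solutions of the
  Navier–Stokes equations*, Comm. PDE 34 (2009), 171–201, arXiv:0804.1803, Thm. 1.1 = Thm. 3.1,
  Lemma 3.5, Prop. 3.7, §4. [SereginSverak2009]
* G. Koch, N. Nadirashvili, G. Seregin, V. Šverák, *Liouville theorems for the Navier–Stokes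
  equations and applications*, Acta Math. 203 (2009), 83–105, arXiv:0709.3599, Thm. 5.3, §6.
  [KochNadirashviliSereginSverak2009]
-/

noncomputable section

open MeasureTheory Set Function
open scoped ENNReal

namespace Literature.Barriers.NavierStokesRegularity

/-- **The barrier `AxisymmetricTypeIExclusion` holds unconditionally** (Seregin–Šverák 2009,
Thm. 3.1 = Thm. 1.1): the tree theorem
`Literature.Analysis.FluidPDE.axisymmetricTypeIExclusion_of_tree` under the canonical `_holds`
name of the barrier fact. [cite: SereginSverak2009, Thm. 3.1 (= Thm. 1.1)] -/
theorem AxisymmetricTypeIExclusion_holds : AxisymmetricTypeIExclusion :=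
  Literature.Analysis.FluidPDE.axisymmetricTypeIExclusion_of_tree

/-- **No axisymmetric Type I singularity, unconditionally** (KNSS 2009, §1: axisymmetric
singularities are of Type II): the non-existence reformulation
`AxisymmetricTypeIExclusion.no_typeI_singularity` of the barrier applied to
`AxisymmetricTypeIExclusion_holds` — there is no distributional solution in the unit cylinder
with `u ∈ L³`, `p ∈ L^{3/2}`, axisymmetric slices and the Type I bound whose origin is singular.
[cite: SereginSverak2009, Thm. 3.1 (= Thm. 1.1) and §1] -/
theorem no_axisymmetric_typeI_singularity :
    ¬ ∃ (u : ℝ → EuclideanSpace ℝ (Fin 3) → EuclideanSpace ℝ (Fin 3))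
        (p : ℝ → EuclideanSpace ℝ (Fin 3) → ℝ),
      Literature.Analysis.FluidPDE.IsDistributionalNSSolutionOn ssCylinderOpens 1 0 u p ∧
      (∫⁻ z in ssCylinder, ‖u z.1 z.2‖ₑ ^ (3 : ℕ) < ∞) ∧
      (∫⁻ z in ssCylinder, ‖p z.1 z.2‖ₑ ^ (3 / 2 : ℝ) < ∞) ∧
      (∀ t ∈ Ioo (-1 : ℝ) 0, Literature.Analysis.FluidPDE.IsAxisymmetric (u t)) ∧
      (∃ C : ℝ, ∀ᵐ z ∂(volume.restrict ssCylinder), Real.sqrt (-z.1) * ‖u z.1 z.2‖ ≤ C) ∧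
      ∀ r > 0, eLpNorm (uncurry u) ∞
        (volume.restrict (Literature.Analysis.FluidPDE.parabolicCylinder r (0, 0))) = ∞ :=
  AxisymmetricTypeIExclusion_holds.no_typeI_singularity

end Literature.Barriers.NavierStokesRegularity
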